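/-
Copyright (c) 2026 the pub-hodgecm-mathlib formalisation cell (harness21).  Prover seat hodgecm-mathlib-R90-C131-p02 (g0) (R90-TF S4 hand lent to L1
by CHAIR VALVE WORD W4), Track B «K2-LIT», hLiu418 = `stmt-HodgeConjecture-24832`; K1-a♮ line lead K2E5-p16 (g8) WORD #11 (α) (arch letters) ∕ block-D
D-3 `hAzero` («the archimedean vanishing at its own real parameter», R90-C131-p02 lineage per LH4-p17 01:04Z).  THEOREMS ONLY (no `def`, no instance, no
notation, no named-fact hypothesis, no `sorry`); lane `--supports stmt-HodgeConjecture-24832 --as helper`.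
-/
import Summits.HodgeConjecture.HodgeConjecture.Theorems.K2LiuArchTwistedScalarBlockExplicit      -- ★ p863574 (iii-a) the h-explicit continued value
import Summits.HodgeConjecture.HodgeConjecture.Theorems.K2LiuArchTwistedScalarBlockParamSmooth   -- ★ p863550 (ii) the universal continuation witness `Φ`
import Summits.HodgeConjecture.HodgeConjecture.Theorems.K2LiuArchTwistedScalarBlockExplicitNeg   -- ★ p864005 (iii-a⁻) the negative-index explicit twin
import HarnessLib

/-!
# Crux `HLiu418`, KIND 1 a♮: the scalar-type archimedean place letters in EXPLICIT form — `Ac s h` = ★ p863574's formula with the universal witness `Φ`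
# of ★ p863550 — holomorphic on `{0 < re s}`, equal to the twisted block on `{½ < re s}`, and VANISHING wherever `Γ(s+1−k/2)⁻¹ = 0` (the sign letter)

Cell `hodgecm-mathlib`, crux item hLiu418 = `stmt-HodgeConjecture-24832` (helper lane, count-neutral).  ★ `exists_archLetters_scalarType` (ED. 1) packages
the arch letters by CHOICE over the point; this file gives them EXPLICITLY: with the ONE witness `Φ` of ★ (ii) (universal in `(α₀, β₀, p)`), the weight
coordinates `(p(h), w(h), q(h))` of `aᴴ(2V(h))a` read off the matrix entries (★ `hermTwo_eq_of_isHermitian`), and ★ p863574's product, the letter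
`Ac s h` is a closed expression — hence (i) holomorphic on `{0 < re s}` factorwise, (ii) equal to the twisted block on `{½ < re s}`, and (iii) **ZERO at
every `s` with `s + 1 − k/2 ∈ −ℕ`** (the factor `Γ(s+1−k/2)⁻¹`; e.g. the centre `s = k/2 − 1` of the weight-`k` holomorphic point) and at every `s` with
`s + 1 + k/2 ∈ −ℕ` or `s + k/2 ∈ −ℕ` — the «vanishing at its own parameter» shape of block-D's D-3 `hAzero` for the positive index `a·diag(t,0)·aᴴ`.
* §1 `differentiableOn_continuedFormula`; §2 `continuedFormula_eq_zero_of_beta`, `continuedFormula_eq_zero_of_alpha`; §3 **`exists_archLetters_scalarType_explicit`**;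
* §4 (ED. 2) the NEGATIVE index over ★ (iii-a⁻): `differentiableOn_continuedFormula_neg`, `continuedFormula_neg_eq_zero_of_alpha/_of_beta`, **`exists_archLetters_scalarType_explicit_neg`**.

HONEST LABEL: scalar `K_w`-type, non-negative index (the `T ≤ 0` twin needs the explicit twin of ★ (3c-cont⁻), next); closes no socket.  HC_CM is proved only
modulo the 7 printed citations (2 remaining named inputs: hLiu418 = `stmt-HodgeConjecture-24832`, h413 = `stmt-HodgeConjecture-24833`) until rung 0 closes.

## References
* [Shimura1982] G. Shimura, *Confluent hypergeometric functions on tube domains*, Math. Ann. 260 (1982), §3 Thm. 3.1, §4 Thm. 4.2, (4.34.K).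
* [Shimura1997] G. Shimura, *Euler Products and Eisenstein Series*, CBMS 93 (1997), §16.4, §18.4–18.5.
* [GanQiuTakeda2014] W. T. Gan, Y. Qiu, S. Takeda, *The regularized Siegel–Weil formula (the second term identity)*, Invent. Math. 198 (2014), §6.4.
-/

set_option autoImplicit false
set_option linter.dupNamespace false

noncomputable section

open Complex MeasureTheory Set Matrix
open scoped ComplexOrder ComplexConjugate

namespace Summit.HodgeConjecture.HodgeConjecture.Cruxes.HLiu418.K2LiuArchTwistedScalarLettersExplicit

open Literature.NumberTheory.ModularForms.SiegelUpperHalfSpace (num denom moeb)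
open Summit.HodgeConjecture.HodgeConjecture.Cruxes.HLiu418.K2LiuHermTwoGammaDefs
open Summit.HodgeConjecture.HodgeConjecture.Cruxes.HLiu418.K2LiuHermTwoEtaDefs
open Summit.HodgeConjecture.HodgeConjecture.Cruxes.HLiu418.K2LiuHermitianTubeCocycle
open Summit.HodgeConjecture.HodgeConjecture.Cruxes.HLiu418.K2LiuArchInducedTubeDefs
open Summit.HodgeConjecture.HodgeConjecture.Cruxes.HLiu418.K2LiuHermTwoEtaRankOneReduction
open Summit.HodgeConjecture.HodgeConjecture.Cruxes.HLiu418.K2LiuLocalKernelArchPlaceFactor (differentiableOn_Gamma_two_mul)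
open Summit.HodgeConjecture.HodgeConjecture.Cruxes.HLiu418.K2LiuArchTwistedScalarBlockContinuation
open Summit.HodgeConjecture.HodgeConjecture.Cruxes.HLiu418.K2LiuArchTwistedScalarBlockExplicit
open Summit.HodgeConjecture.HodgeConjecture.Cruxes.HLiu418.K2LiuArchTwistedScalarBlockParamSmooth
open Summit.HodgeConjecture.HodgeConjecture.Cruxes.HLiu418.K2LiuArchTwistedScalarBlockExplicitNeg

/-! ## §1 The explicit formula is holomorphic on `{0 < re s}` -/

/-- **The continued formula of ★ p863574, with the weight coordinates read off the entries of `aᴴ(2V(h))a`, is holomorphic on `{0 < re s}`** for every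
`h ∈ U(J)` (`Γ⁻¹`'s entire, `Γ(2s)` on `{0 < re}`, constant cpows, `Φ` by ★ (ii)(a) on `{1 − N < re(1 − k/2 + s)} ⊇ {0 < re s}` since `k/2 < N`).
[Shimura1982, §4 Thm. 4.2] -/
theorem differentiableOn_continuedFormula (k : ℤ) {h : Matrix (Fin 2 ⊕ Fin 2) (Fin 2 ⊕ Fin 2) ℂ}
    (hh : hᴴ * Matrix.J (Fin 2) ℂ * h = Matrix.J (Fin 2) ℂ) (a : Matrix (Fin 2) (Fin 2) ℂ) (ha : IsUnit a) (t : ℝ) {N : ℕ} (hN : (k : ℝ) / 2 < N)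
    (Φ : ℂ → ℂ → ℝ → ℂ → ℂ)
    (hΦa : ∀ (α₀ β₀ : ℂ) (p' : ℝ), 0 < p' → DifferentiableOn ℂ (Φ α₀ β₀ p') {s : ℂ | 1 - N < (β₀ + s).re}) :
    DifferentiableOn ℂ (fun s : ℂ =>
      ((denom h (I • (1 : Matrix (Fin 2) (Fin 2) ℂ))).det ^ (-k) *
          (((‖(denom h (I • (1 : Matrix (Fin 2) (Fin 2) ℂ))).det‖ : ℝ)) : ℂ) ^ ((k : ℂ) - 2 * s - 2) *
          cexp ((2 * Real.pi * I) * ((a * hermTwo (t, 0, 0) * aᴴ) * ((2 : ℂ)⁻¹ • (moeb h (I • (1 : Matrix (Fin 2) (Fin 2) ℂ)) + (moeb h (I • (1 : Matrix (Fin 2) (Fin 2) ℂ)))ᴴ))).trace)) *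
        ((1 / 8 : ℂ) * ((((4 * Real.pi ^ 4 : ℝ)) : ℂ) * cexp ((Real.pi * I) * ((s + 1 - k / 2) - (s + 1 + k / 2))) *
          ((Real.pi : ℂ)⁻¹ * (Complex.Gamma (s + 1 + k / 2))⁻¹ * (Complex.Gamma (s + 1 + k / 2 - 1))⁻¹) *
          ((Real.pi : ℂ)⁻¹ * (Complex.Gamma (s + 1 - k / 2))⁻¹) *
          ((Real.pi : ℂ) / (((aᴴ * ((2 : ℂ) • ((2 * I)⁻¹ • (moeb h (I • (1 : Matrix (Fin 2) (Fin 2) ℂ)) - (moeb h (I • (1 : Matrix (Fin 2) (Fin 2) ℂ)))ᴴ))) * a) 0 0).re) * cexp (-(((((aᴴ * ((2 : ℂ) • ((2 * I)⁻¹ • (moeb h (I • (1 : Matrix (Fin 2) (Fin 2) ℂ)) - (moeb h (I • (1 : Matrix (Fin 2) (Fin 2) ℂ)))ᴴ))) * a) 0 0).re) * (Real.pi * t) : ℝ) : ℂ)) *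
            ((1 / (((((aᴴ * ((2 : ℂ) • ((2 * I)⁻¹ • (moeb h (I • (1 : Matrix (Fin 2) (Fin 2) ℂ)) - (moeb h (I • (1 : Matrix (Fin 2) (Fin 2) ℂ)))ᴴ))) * a) 1 1).re) - normSq ((aᴴ * ((2 : ℂ) • ((2 * I)⁻¹ • (moeb h (I • (1 : Matrix (Fin 2) (Fin 2) ℂ)) - (moeb h (I • (1 : Matrix (Fin 2) (Fin 2) ℂ)))ᴴ))) * a) 0 1) / (((aᴴ * ((2 : ℂ) • ((2 * I)⁻¹ • (moeb h (I • (1 : Matrix (Fin 2) (Fin 2) ℂ)) - (moeb h (I • (1 : Matrix (Fin 2) (Fin 2) ℂ)))ᴴ))) * a) 0 0).re) : ℝ) : ℂ)) ^ ((s + 1 + k / 2) + (s + 1 - k / 2) - 2) * Complex.Gamma (2 * s)) *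
          Φ (1 + k / 2) (1 - k / 2) (((aᴴ * ((2 : ℂ) • ((2 * I)⁻¹ • (moeb h (I • (1 : Matrix (Fin 2) (Fin 2) ℂ)) - (moeb h (I • (1 : Matrix (Fin 2) (Fin 2) ℂ)))ᴴ))) * a) 0 0).re) s)))) {s : ℂ | 0 < s.re} := by
  set V : Matrix (Fin 2) (Fin 2) ℂ := ((2 * I)⁻¹ • (moeb h (I • (1 : Matrix (Fin 2) (Fin 2) ℂ)) - (moeb h (I • (1 : Matrix (Fin 2) (Fin 2) ℂ)))ᴴ)) with hV
  have hδ0 : (denom h (I • (1 : Matrix (Fin 2) (Fin 2) ℂ))).det ≠ 0 := (isUnit_det_denom hh posDef_im_I_smul_one).ne_zero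
  have hδc : (((‖(denom h (I • (1 : Matrix (Fin 2) (Fin 2) ℂ))).det‖ : ℝ)) : ℂ) ≠ 0 := by exact_mod_cast (norm_pos_iff.mpr hδ0).ne'
  have hVpos : V.PosDef := posDef_im_moeb hh posDef_im_I_smul_one
  have h2V : ((2 : ℂ) • V).PosDef := by
    have h := hVpos.smul (by norm_num : (0 : ℝ) < 2)
    rwa [show ((2 : ℝ) • V) = ((2 : ℂ) • V) by rw [← Complex.coe_smul]; norm_num] at h
  have hg' : (aᴴ * ((2 : ℂ) • V) * a).PosDef := by
    have := Matrix.IsUnit.posDef_star_left_conjugate_iff (x := (2 : ℂ) • V) ha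
    rw [Matrix.star_eq_conjTranspose] at this
    exact this.mpr h2V
  have he := hermTwo_eq_of_isHermitian hg'.1
  have hg'' : (hermTwo ((((aᴴ * ((2 : ℂ) • V) * a) 0 0).re), ((aᴴ * ((2 : ℂ) • V) * a) 0 1), (((aᴴ * ((2 : ℂ) • V) * a) 1 1).re))).PosDef := by rw [he]; exact hg'
  obtain ⟨hp, hpq⟩ := (posDef_hermTwo_iff _).mp hg''
  simp only at hp hpq
  have hsub : {s : ℂ | 0 < s.re} ⊆ {s : ℂ | 1 - (N : ℝ) < ((1 - k / 2 : ℂ) + s).re} := by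
    intro s hs
    simp only [mem_setOf_eq, add_re, sub_re, one_re, div_ofNat_re, intCast_re] at hs ⊢
    linarith
  have hq0 : (1 / ((((((aᴴ * ((2 : ℂ) • V) * a) 1 1).re) - normSq ((aᴴ * ((2 : ℂ) • V) * a) 0 1) / (((aᴴ * ((2 : ℂ) • V) * a) 0 0).re) : ℝ)) : ℂ)) ≠ 0 := by
    have : 0 < ((((aᴴ * ((2 : ℂ) • V) * a) 1 1).re) - normSq ((aᴴ * ((2 : ℂ) • V) * a) 0 1) / (((aᴴ * ((2 : ℂ) • V) * a) 0 0).re) : ℝ) := by rw [sub_pos, div_lt_iff₀ hp]; linarith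
    exact one_div_ne_zero (by exact_mod_cast this.ne')
  have hP : Differentiable ℂ (fun s : ℂ => (denom h (I • (1 : Matrix (Fin 2) (Fin 2) ℂ))).det ^ (-k) * (((‖(denom h (I • (1 : Matrix (Fin 2) (Fin 2) ℂ))).det‖ : ℝ)) : ℂ) ^ ((k : ℂ) - 2 * s - 2) *
      cexp ((2 * Real.pi * I) * ((a * hermTwo (t, 0, 0) * aᴴ) * ((2 : ℂ)⁻¹ • (moeb h (I • (1 : Matrix (Fin 2) (Fin 2) ℂ)) + (moeb h (I • (1 : Matrix (Fin 2) (Fin 2) ℂ)))ᴴ))).trace)) := by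
    refine ((differentiable_const _).mul fun s => ?_).mul (differentiable_const _)
    exact ((((differentiableAt_const _).sub ((differentiableAt_id).const_mul _)).sub_const _).const_cpow (Or.inl hδc))
  have hC : Differentiable ℂ (fun s : ℂ => (((4 * Real.pi ^ 4 : ℝ)) : ℂ) * cexp ((Real.pi * I) * ((s + 1 - k / 2) - (s + 1 + k / 2))) *
      ((Real.pi : ℂ)⁻¹ * (Complex.Gamma (s + 1 + k / 2))⁻¹ * (Complex.Gamma (s + 1 + k / 2 - 1))⁻¹) *
      ((Real.pi : ℂ)⁻¹ * (Complex.Gamma (s + 1 - k / 2))⁻¹)) := by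
    refine (((differentiable_const _).mul ?_).mul ?_).mul ?_
    · exact (((differentiable_const _).mul ((((differentiable_id).add_const _).sub_const _).sub
        (((differentiable_id).add_const _).add_const _)))).cexp
    · refine ((differentiable_const _).mul ?_).mul ?_
      · exact Complex.differentiable_one_div_Gamma.comp (((differentiable_id).add_const _).add_const _)
      · exact Complex.differentiable_one_div_Gamma.comp ((((differentiable_id).add_const _).add_const _).sub_const _)
    · exact (differentiable_const _).mul (Complex.differentiable_one_div_Gamma.comp (((differentiable_id).add_const _).sub_const _))
  have hR : DifferentiableOn ℂ (fun s : ℂ => (Real.pi : ℂ) / (((aᴴ * ((2 : ℂ) • V) * a) 0 0).re) * cexp (-(((((aᴴ * ((2 : ℂ) • V) * a) 0 0).re) * (Real.pi * t) : ℝ) : ℂ)) *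
      ((1 / ((((((aᴴ * ((2 : ℂ) • V) * a) 1 1).re) - normSq ((aᴴ * ((2 : ℂ) • V) * a) 0 1) / (((aᴴ * ((2 : ℂ) • V) * a) 0 0).re) : ℝ)) : ℂ)) ^ ((s + 1 + k / 2) + (s + 1 - k / 2) - 2) * Complex.Gamma (2 * s))) {s : ℂ | 0 < s.re} := by
    refine ((differentiableOn_const _).mul ?_)
    refine DifferentiableOn.mul (fun s _ => ?_) differentiableOn_Gamma_two_mul
    exact (((((differentiableAt_id).add_const _).add_const _).add (((differentiableAt_id).add_const _).sub_const _)).sub_const _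
      |>.const_cpow (Or.inl hq0)).differentiableWithinAt
  exact hP.differentiableOn.mul (((differentiableOn_const _).mul (hC.differentiableOn.mul (hR.mul ((hΦa _ _ _ hp).mono hsub)))))

/-! ## §2 The vanishing at the zeros of the `Γ⁻¹` factors (the sign letter) -/

/-- **VANISHING WHERE `Γ(s + 1 − k/2)⁻¹ = 0`**: if `s + 1 − k/2 = −m` (`m : ℕ`), the continued formula is `0` (whatever `h`, `Φ`). [Shimura1982, (4.34.K)] -/
theorem continuedFormula_eq_zero_of_beta (k : ℤ) (h : Matrix (Fin 2 ⊕ Fin 2) (Fin 2 ⊕ Fin 2) ℂ) (a : Matrix (Fin 2) (Fin 2) ℂ) (t : ℝ)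
    (Φ : ℂ → ℂ → ℝ → ℂ → ℂ) {s : ℂ} (hβ : ∃ m : ℕ, s + 1 - k / 2 = -(m : ℂ)) :
    ((denom h (I • (1 : Matrix (Fin 2) (Fin 2) ℂ))).det ^ (-k) *
        (((‖(denom h (I • (1 : Matrix (Fin 2) (Fin 2) ℂ))).det‖ : ℝ)) : ℂ) ^ ((k : ℂ) - 2 * s - 2) *
        cexp ((2 * Real.pi * I) * ((a * hermTwo (t, 0, 0) * aᴴ) * ((2 : ℂ)⁻¹ • (moeb h (I • (1 : Matrix (Fin 2) (Fin 2) ℂ)) + (moeb h (I • (1 : Matrix (Fin 2) (Fin 2) ℂ)))ᴴ))).trace)) *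
      ((1 / 8 : ℂ) * ((((4 * Real.pi ^ 4 : ℝ)) : ℂ) * cexp ((Real.pi * I) * ((s + 1 - k / 2) - (s + 1 + k / 2))) *
        ((Real.pi : ℂ)⁻¹ * (Complex.Gamma (s + 1 + k / 2))⁻¹ * (Complex.Gamma (s + 1 + k / 2 - 1))⁻¹) *
        ((Real.pi : ℂ)⁻¹ * (Complex.Gamma (s + 1 - k / 2))⁻¹) *
        ((Real.pi : ℂ) / (((aᴴ * ((2 : ℂ) • ((2 * I)⁻¹ • (moeb h (I • (1 : Matrix (Fin 2) (Fin 2) ℂ)) - (moeb h (I • (1 : Matrix (Fin 2) (Fin 2) ℂ)))ᴴ))) * a) 0 0).re) * cexp (-(((((aᴴ * ((2 : ℂ) • ((2 * I)⁻¹ • (moeb h (I • (1 : Matrix (Fin 2) (Fin 2) ℂ)) - (moeb h (I • (1 : Matrix (Fin 2) (Fin 2) ℂ)))ᴴ))) * a) 0 0).re) * (Real.pi * t) : ℝ) : ℂ)) *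
          ((1 / (((((aᴴ * ((2 : ℂ) • ((2 * I)⁻¹ • (moeb h (I • (1 : Matrix (Fin 2) (Fin 2) ℂ)) - (moeb h (I • (1 : Matrix (Fin 2) (Fin 2) ℂ)))ᴴ))) * a) 1 1).re) - normSq ((aᴴ * ((2 : ℂ) • ((2 * I)⁻¹ • (moeb h (I • (1 : Matrix (Fin 2) (Fin 2) ℂ)) - (moeb h (I • (1 : Matrix (Fin 2) (Fin 2) ℂ)))ᴴ))) * a) 0 1) / (((aᴴ * ((2 : ℂ) • ((2 * I)⁻¹ • (moeb h (I • (1 : Matrix (Fin 2) (Fin 2) ℂ)) - (moeb h (I • (1 : Matrix (Fin 2) (Fin 2) ℂ)))ᴴ))) * a) 0 0).re) : ℝ) : ℂ)) ^ ((s + 1 + k / 2) + (s + 1 - k / 2) - 2) * Complex.Gamma (2 * s)) *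
        Φ (1 + k / 2) (1 - k / 2) (((aᴴ * ((2 : ℂ) • ((2 * I)⁻¹ • (moeb h (I • (1 : Matrix (Fin 2) (Fin 2) ℂ)) - (moeb h (I • (1 : Matrix (Fin 2) (Fin 2) ℂ)))ᴴ))) * a) 0 0).re) s))) = 0 := by
  obtain ⟨m, hm⟩ := hβ
  rw [hm, Complex.Gamma_neg_nat_eq_zero, _root_.inv_zero, mul_zero]
  simp

/-- **VANISHING WHERE `Γ(s + 1 + k/2)⁻¹Γ(s + k/2)⁻¹ = 0`**: if `s + 1 + k/2 = −m` or `s + 1 + k/2 − 1 = −m` (`m : ℕ`), the continued formula is `0`. [Shimura1982, (4.34.K)] -/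
theorem continuedFormula_eq_zero_of_alpha (k : ℤ) (h : Matrix (Fin 2 ⊕ Fin 2) (Fin 2 ⊕ Fin 2) ℂ) (a : Matrix (Fin 2) (Fin 2) ℂ) (t : ℝ)
    (Φ : ℂ → ℂ → ℝ → ℂ → ℂ) {s : ℂ} (hα : ∃ m : ℕ, s + 1 + k / 2 = -(m : ℂ) ∨ s + 1 + k / 2 - 1 = -(m : ℂ)) :
    ((denom h (I • (1 : Matrix (Fin 2) (Fin 2) ℂ))).det ^ (-k) *
        (((‖(denom h (I • (1 : Matrix (Fin 2) (Fin 2) ℂ))).det‖ : ℝ)) : ℂ) ^ ((k : ℂ) - 2 * s - 2) *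
        cexp ((2 * Real.pi * I) * ((a * hermTwo (t, 0, 0) * aᴴ) * ((2 : ℂ)⁻¹ • (moeb h (I • (1 : Matrix (Fin 2) (Fin 2) ℂ)) + (moeb h (I • (1 : Matrix (Fin 2) (Fin 2) ℂ)))ᴴ))).trace)) *
      ((1 / 8 : ℂ) * ((((4 * Real.pi ^ 4 : ℝ)) : ℂ) * cexp ((Real.pi * I) * ((s + 1 - k / 2) - (s + 1 + k / 2))) *
        ((Real.pi : ℂ)⁻¹ * (Complex.Gamma (s + 1 + k / 2))⁻¹ * (Complex.Gamma (s + 1 + k / 2 - 1))⁻¹) *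
        ((Real.pi : ℂ)⁻¹ * (Complex.Gamma (s + 1 - k / 2))⁻¹) *
        ((Real.pi : ℂ) / (((aᴴ * ((2 : ℂ) • ((2 * I)⁻¹ • (moeb h (I • (1 : Matrix (Fin 2) (Fin 2) ℂ)) - (moeb h (I • (1 : Matrix (Fin 2) (Fin 2) ℂ)))ᴴ))) * a) 0 0).re) * cexp (-(((((aᴴ * ((2 : ℂ) • ((2 * I)⁻¹ • (moeb h (I • (1 : Matrix (Fin 2) (Fin 2) ℂ)) - (moeb h (I • (1 : Matrix (Fin 2) (Fin 2) ℂ)))ᴴ))) * a) 0 0).re) * (Real.pi * t) : ℝ) : ℂ)) *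
          ((1 / (((((aᴴ * ((2 : ℂ) • ((2 * I)⁻¹ • (moeb h (I • (1 : Matrix (Fin 2) (Fin 2) ℂ)) - (moeb h (I • (1 : Matrix (Fin 2) (Fin 2) ℂ)))ᴴ))) * a) 1 1).re) - normSq ((aᴴ * ((2 : ℂ) • ((2 * I)⁻¹ • (moeb h (I • (1 : Matrix (Fin 2) (Fin 2) ℂ)) - (moeb h (I • (1 : Matrix (Fin 2) (Fin 2) ℂ)))ᴴ))) * a) 0 1) / (((aᴴ * ((2 : ℂ) • ((2 * I)⁻¹ • (moeb h (I • (1 : Matrix (Fin 2) (Fin 2) ℂ)) - (moeb h (I • (1 : Matrix (Fin 2) (Fin 2) ℂ)))ᴴ))) * a) 0 0).re) : ℝ) : ℂ)) ^ ((s + 1 + k / 2) + (s + 1 - k / 2) - 2) * Complex.Gamma (2 * s)) *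
        Φ (1 + k / 2) (1 - k / 2) (((aᴴ * ((2 : ℂ) • ((2 * I)⁻¹ • (moeb h (I • (1 : Matrix (Fin 2) (Fin 2) ℂ)) - (moeb h (I • (1 : Matrix (Fin 2) (Fin 2) ℂ)))ᴴ))) * a) 0 0).re) s))) = 0 := by
  obtain ⟨m, hm | hm⟩ := hα
  · rw [hm, Complex.Gamma_neg_nat_eq_zero, _root_.inv_zero, mul_zero, zero_mul]
    simp
  · rw [hm, Complex.Gamma_neg_nat_eq_zero, _root_.inv_zero, mul_zero]
    simp

/-! ## §3 The explicit letters -/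

/-- **THE SCALAR-TYPE ARCH LETTERS, EXPLICIT, WITH THE SIGN LETTER** (non-negative index `T = a·diag(t,0)·aᴴ`, `‖det a‖ = 1`, `t > 0`, `k/2 < N`): there is
`Ac : ℂ → M₄(ℂ) → ℂ` with (hAc) `s ↦ Ac s h` holomorphic on `{0 < re s}` for every `h ∈ U(J)`; (hA) `∫ e(−τ(T·X)) f⁰_{s,k}(J n(X) h) dX = Ac s h` for `½ < re s`,
`h ∈ U(J)`; (hAzero-β) `Ac s h = 0` whenever `s + 1 − k/2 ∈ −ℕ`; (hAzero-α) `Ac s h = 0` whenever `s + 1 + k/2 ∈ −ℕ` or `s + k/2 ∈ −ℕ` — for ALL `h`.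
(`Ac` := ★ p863574's formula with ★ (ii)'s universal witness and the weight coordinates read off `aᴴ(2V(h))a`.) [Shimura1982, §4 Thm. 4.2, (4.34.K)] [GanQiuTakeda2014, §6.4] -/
theorem exists_archLetters_scalarType_explicit (k : ℤ) {a : Matrix (Fin 2) (Fin 2) ℂ} (hdet : ‖a.det‖ = 1) {t : ℝ} (ht : 0 < t) {N : ℕ}
    (hN : (k : ℝ) / 2 < N) :
    ∃ Ac : ℂ → Matrix (Fin 2 ⊕ Fin 2) (Fin 2 ⊕ Fin 2) ℂ → ℂ,
      (∀ h : Matrix (Fin 2 ⊕ Fin 2) (Fin 2 ⊕ Fin 2) ℂ, hᴴ * Matrix.J (Fin 2) ℂ * h = Matrix.J (Fin 2) ℂ →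
        DifferentiableOn ℂ (fun s => Ac s h) {s : ℂ | 0 < s.re}) ∧
      (∀ s : ℂ, 1 / 2 < s.re → ∀ h : Matrix (Fin 2 ⊕ Fin 2) (Fin 2 ⊕ Fin 2) ℂ, hᴴ * Matrix.J (Fin 2) ℂ * h = Matrix.J (Fin 2) ℂ →
        (∫ r : Fin 2 → Fin 2 → ℝ, cexp (-(2 * Real.pi * I) * ((a * hermTwo (t, 0, 0) * aᴴ) * hermOfReal r).trace) *
          archScalarSection k s (Matrix.J (Fin 2) ℂ * fromBlocks 1 (hermOfReal r) 0 1 * h)) = Ac s h) ∧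
      (∀ (s : ℂ) (h : Matrix (Fin 2 ⊕ Fin 2) (Fin 2 ⊕ Fin 2) ℂ), (∃ m : ℕ, s + 1 - k / 2 = -(m : ℂ)) → Ac s h = 0) ∧
      (∀ (s : ℂ) (h : Matrix (Fin 2 ⊕ Fin 2) (Fin 2 ⊕ Fin 2) ℂ), (∃ m : ℕ, s + 1 + k / 2 = -(m : ℂ) ∨ s + 1 + k / 2 - 1 = -(m : ℂ)) → Ac s h = 0) := by
  have ha0 : a.det ≠ 0 := fun h0 => by rw [h0, norm_zero] at hdet; exact zero_ne_one hdet
  have haU : IsUnit a := (Matrix.isUnit_iff_isUnit_det a).mpr (Ne.isUnit ha0)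
  have hπt : 0 < Real.pi * t := by positivity
  obtain ⟨Φ, hΦa, hΦb, -, -⟩ := exists_continuation_jIntegral_param hπt N
  refine ⟨fun s h =>
      ((denom h (I • (1 : Matrix (Fin 2) (Fin 2) ℂ))).det ^ (-k) *
          (((‖(denom h (I • (1 : Matrix (Fin 2) (Fin 2) ℂ))).det‖ : ℝ)) : ℂ) ^ ((k : ℂ) - 2 * s - 2) *
          cexp ((2 * Real.pi * I) * ((a * hermTwo (t, 0, 0) * aᴴ) * ((2 : ℂ)⁻¹ • (moeb h (I • (1 : Matrix (Fin 2) (Fin 2) ℂ)) + (moeb h (I • (1 : Matrix (Fin 2) (Fin 2) ℂ)))ᴴ))).trace)) *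
        ((1 / 8 : ℂ) * ((((4 * Real.pi ^ 4 : ℝ)) : ℂ) * cexp ((Real.pi * I) * ((s + 1 - k / 2) - (s + 1 + k / 2))) *
          ((Real.pi : ℂ)⁻¹ * (Complex.Gamma (s + 1 + k / 2))⁻¹ * (Complex.Gamma (s + 1 + k / 2 - 1))⁻¹) *
          ((Real.pi : ℂ)⁻¹ * (Complex.Gamma (s + 1 - k / 2))⁻¹) *
          ((Real.pi : ℂ) / (((aᴴ * ((2 : ℂ) • ((2 * I)⁻¹ • (moeb h (I • (1 : Matrix (Fin 2) (Fin 2) ℂ)) - (moeb h (I • (1 : Matrix (Fin 2) (Fin 2) ℂ)))ᴴ))) * a) 0 0).re) * cexp (-(((((aᴴ * ((2 : ℂ) • ((2 * I)⁻¹ • (moeb h (I • (1 : Matrix (Fin 2) (Fin 2) ℂ)) - (moeb h (I • (1 : Matrix (Fin 2) (Fin 2) ℂ)))ᴴ))) * a) 0 0).re) * (Real.pi * t) : ℝ) : ℂ)) *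
            ((1 / (((((aᴴ * ((2 : ℂ) • ((2 * I)⁻¹ • (moeb h (I • (1 : Matrix (Fin 2) (Fin 2) ℂ)) - (moeb h (I • (1 : Matrix (Fin 2) (Fin 2) ℂ)))ᴴ))) * a) 1 1).re) - normSq ((aᴴ * ((2 : ℂ) • ((2 * I)⁻¹ • (moeb h (I • (1 : Matrix (Fin 2) (Fin 2) ℂ)) - (moeb h (I • (1 : Matrix (Fin 2) (Fin 2) ℂ)))ᴴ))) * a) 0 1) / (((aᴴ * ((2 : ℂ) • ((2 * I)⁻¹ • (moeb h (I • (1 : Matrix (Fin 2) (Fin 2) ℂ)) - (moeb h (I • (1 : Matrix (Fin 2) (Fin 2) ℂ)))ᴴ))) * a) 0 0).re) : ℝ) : ℂ)) ^ ((s + 1 + k / 2) + (s + 1 - k / 2) - 2) * Complex.Gamma (2 * s)) *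
          Φ (1 + k / 2) (1 - k / 2) (((aᴴ * ((2 : ℂ) • ((2 * I)⁻¹ • (moeb h (I • (1 : Matrix (Fin 2) (Fin 2) ℂ)) - (moeb h (I • (1 : Matrix (Fin 2) (Fin 2) ℂ)))ᴴ))) * a) 0 0).re) s))),
    fun h hh => differentiableOn_continuedFormula k hh a haU t hN Φ hΦa, fun s hs h hh => ?_,
    fun s h hβ => continuedFormula_eq_zero_of_beta k h a t Φ hβ, fun s h hα => continuedFormula_eq_zero_of_alpha k h a t Φ hα⟩
  -- (hA): ★ p863574 at the weight coordinates read off the entries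
  set V : Matrix (Fin 2) (Fin 2) ℂ := ((2 * I)⁻¹ • (moeb h (I • (1 : Matrix (Fin 2) (Fin 2) ℂ)) - (moeb h (I • (1 : Matrix (Fin 2) (Fin 2) ℂ)))ᴴ)) with hV
  have hVpos : V.PosDef := posDef_im_moeb hh posDef_im_I_smul_one
  have h2V : ((2 : ℂ) • V).PosDef := by
    have h := hVpos.smul (by norm_num : (0 : ℝ) < 2)
    rwa [show ((2 : ℝ) • V) = ((2 : ℂ) • V) by rw [← Complex.coe_smul]; norm_num] at h
  have hg' : (aᴴ * ((2 : ℂ) • V) * a).PosDef := by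
    have := Matrix.IsUnit.posDef_star_left_conjugate_iff (x := (2 : ℂ) • V) haU
    rw [Matrix.star_eq_conjTranspose] at this
    exact this.mpr h2V
  have he := hermTwo_eq_of_isHermitian hg'.1
  exact twistedArchBlock_scalarType_eq_continued k hh hdet ht hN he Φ hΦa hΦb hs

/-! ## §4 (ED. 2) The NEGATIVE index `−a·diag(t,0)·aᴴ`: holomorphy, vanishing, explicit letters (over ★ `twistedArchBlock_scalarType_eq_continued_neg`) -/

/-- The negative-index continued formula (★ (iii-a⁻)) is holomorphic on `{0 < re s}` for every `h ∈ U(J)` (`−k/2 < N`). [Shimura1982, §4 Thm. 4.2] -/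
theorem differentiableOn_continuedFormula_neg (k : ℤ) {h : Matrix (Fin 2 ⊕ Fin 2) (Fin 2 ⊕ Fin 2) ℂ}
    (hh : hᴴ * Matrix.J (Fin 2) ℂ * h = Matrix.J (Fin 2) ℂ) (a : Matrix (Fin 2) (Fin 2) ℂ) (ha : IsUnit a) (t : ℝ) {N : ℕ} (hN : -(k : ℝ) / 2 < N)
    (Φ : ℂ → ℂ → ℝ → ℂ → ℂ)
    (hΦa : ∀ (α₀ β₀ : ℂ) (p' : ℝ), 0 < p' → DifferentiableOn ℂ (Φ α₀ β₀ p') {s : ℂ | 1 - N < (β₀ + s).re}) :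
    DifferentiableOn ℂ (fun s : ℂ =>
      ((denom h (I • (1 : Matrix (Fin 2) (Fin 2) ℂ))).det ^ (-k) *
          (((‖(denom h (I • (1 : Matrix (Fin 2) (Fin 2) ℂ))).det‖ : ℝ)) : ℂ) ^ ((k : ℂ) - 2 * s - 2) *
          cexp ((2 * Real.pi * I) * ((-(a * hermTwo (t, 0, 0) * aᴴ)) * ((2 : ℂ)⁻¹ • (moeb h (I • (1 : Matrix (Fin 2) (Fin 2) ℂ)) + (moeb h (I • (1 : Matrix (Fin 2) (Fin 2) ℂ)))ᴴ))).trace)) *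
        ((1 / 8 : ℂ) * ((((4 * Real.pi ^ 4 : ℝ)) : ℂ) * cexp ((Real.pi * I) * ((s + 1 - k / 2) - (s + 1 + k / 2))) *
          ((Real.pi : ℂ)⁻¹ * (Complex.Gamma (s + 1 + k / 2))⁻¹) *
          ((Real.pi : ℂ)⁻¹ * (Complex.Gamma (s + 1 - k / 2))⁻¹ * (Complex.Gamma (s + 1 - k / 2 - 1))⁻¹) *
          ((Real.pi : ℂ) / (((aᴴ * ((2 : ℂ) • ((2 * I)⁻¹ • (moeb h (I • (1 : Matrix (Fin 2) (Fin 2) ℂ)) - (moeb h (I • (1 : Matrix (Fin 2) (Fin 2) ℂ)))ᴴ))) * a) 0 0).re) * cexp (-(((((aᴴ * ((2 : ℂ) • ((2 * I)⁻¹ • (moeb h (I • (1 : Matrix (Fin 2) (Fin 2) ℂ)) - (moeb h (I • (1 : Matrix (Fin 2) (Fin 2) ℂ)))ᴴ))) * a) 0 0).re) * (Real.pi * t) : ℝ) : ℂ)) *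
            ((1 / (((((aᴴ * ((2 : ℂ) • ((2 * I)⁻¹ • (moeb h (I • (1 : Matrix (Fin 2) (Fin 2) ℂ)) - (moeb h (I • (1 : Matrix (Fin 2) (Fin 2) ℂ)))ᴴ))) * a) 1 1).re) - normSq ((aᴴ * ((2 : ℂ) • ((2 * I)⁻¹ • (moeb h (I • (1 : Matrix (Fin 2) (Fin 2) ℂ)) - (moeb h (I • (1 : Matrix (Fin 2) (Fin 2) ℂ)))ᴴ))) * a) 0 1) / (((aᴴ * ((2 : ℂ) • ((2 * I)⁻¹ • (moeb h (I • (1 : Matrix (Fin 2) (Fin 2) ℂ)) - (moeb h (I • (1 : Matrix (Fin 2) (Fin 2) ℂ)))ᴴ))) * a) 0 0).re) : ℝ) : ℂ)) ^ ((s + 1 - k / 2) + (s + 1 + k / 2) - 2) * Complex.Gamma (2 * s)) *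
          Φ (1 - k / 2) (1 + k / 2) (((aᴴ * ((2 : ℂ) • ((2 * I)⁻¹ • (moeb h (I • (1 : Matrix (Fin 2) (Fin 2) ℂ)) - (moeb h (I • (1 : Matrix (Fin 2) (Fin 2) ℂ)))ᴴ))) * a) 0 0).re) s)))) {s : ℂ | 0 < s.re} := by
  set V : Matrix (Fin 2) (Fin 2) ℂ := ((2 * I)⁻¹ • (moeb h (I • (1 : Matrix (Fin 2) (Fin 2) ℂ)) - (moeb h (I • (1 : Matrix (Fin 2) (Fin 2) ℂ)))ᴴ)) with hV
  have hδ0 : (denom h (I • (1 : Matrix (Fin 2) (Fin 2) ℂ))).det ≠ 0 := (isUnit_det_denom hh posDef_im_I_smul_one).ne_zero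
  have hδc : (((‖(denom h (I • (1 : Matrix (Fin 2) (Fin 2) ℂ))).det‖ : ℝ)) : ℂ) ≠ 0 := by exact_mod_cast (norm_pos_iff.mpr hδ0).ne'
  have hVpos : V.PosDef := posDef_im_moeb hh posDef_im_I_smul_one
  have h2V : ((2 : ℂ) • V).PosDef := by
    have h := hVpos.smul (by norm_num : (0 : ℝ) < 2)
    rwa [show ((2 : ℝ) • V) = ((2 : ℂ) • V) by rw [← Complex.coe_smul]; norm_num] at h
  have hg' : (aᴴ * ((2 : ℂ) • V) * a).PosDef := by
    have := Matrix.IsUnit.posDef_star_left_conjugate_iff (x := (2 : ℂ) • V) ha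
    rw [Matrix.star_eq_conjTranspose] at this
    exact this.mpr h2V
  have he := hermTwo_eq_of_isHermitian hg'.1
  have hg'' : (hermTwo ((((aᴴ * ((2 : ℂ) • V) * a) 0 0).re), ((aᴴ * ((2 : ℂ) • V) * a) 0 1), (((aᴴ * ((2 : ℂ) • V) * a) 1 1).re))).PosDef := by rw [he]; exact hg'
  obtain ⟨hp, hpq⟩ := (posDef_hermTwo_iff _).mp hg''
  simp only at hp hpq
  have hsub : {s : ℂ | 0 < s.re} ⊆ {s : ℂ | 1 - (N : ℝ) < ((1 + k / 2 : ℂ) + s).re} := by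
    intro s hs
    simp only [mem_setOf_eq, add_re, one_re, div_ofNat_re, intCast_re] at hs ⊢
    linarith
  have hq0 : (1 / ((((((aᴴ * ((2 : ℂ) • V) * a) 1 1).re) - normSq ((aᴴ * ((2 : ℂ) • V) * a) 0 1) / (((aᴴ * ((2 : ℂ) • V) * a) 0 0).re) : ℝ)) : ℂ)) ≠ 0 := by
    have : 0 < ((((aᴴ * ((2 : ℂ) • V) * a) 1 1).re) - normSq ((aᴴ * ((2 : ℂ) • V) * a) 0 1) / (((aᴴ * ((2 : ℂ) • V) * a) 0 0).re) : ℝ) := by rw [sub_pos, div_lt_iff₀ hp]; linarith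
    exact one_div_ne_zero (by exact_mod_cast this.ne')
  have hP : Differentiable ℂ (fun s : ℂ => (denom h (I • (1 : Matrix (Fin 2) (Fin 2) ℂ))).det ^ (-k) * (((‖(denom h (I • (1 : Matrix (Fin 2) (Fin 2) ℂ))).det‖ : ℝ)) : ℂ) ^ ((k : ℂ) - 2 * s - 2) *
      cexp ((2 * Real.pi * I) * ((-(a * hermTwo (t, 0, 0) * aᴴ)) * ((2 : ℂ)⁻¹ • (moeb h (I • (1 : Matrix (Fin 2) (Fin 2) ℂ)) + (moeb h (I • (1 : Matrix (Fin 2) (Fin 2) ℂ)))ᴴ))).trace)) := by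
    refine ((differentiable_const _).mul fun s => ?_).mul (differentiable_const _)
    exact ((((differentiableAt_const _).sub ((differentiableAt_id).const_mul _)).sub_const _).const_cpow (Or.inl hδc))
  have hC : Differentiable ℂ (fun s : ℂ => (((4 * Real.pi ^ 4 : ℝ)) : ℂ) * cexp ((Real.pi * I) * ((s + 1 - k / 2) - (s + 1 + k / 2))) *
      ((Real.pi : ℂ)⁻¹ * (Complex.Gamma (s + 1 + k / 2))⁻¹) *
      ((Real.pi : ℂ)⁻¹ * (Complex.Gamma (s + 1 - k / 2))⁻¹ * (Complex.Gamma (s + 1 - k / 2 - 1))⁻¹)) := by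
    refine (((differentiable_const _).mul ?_).mul ?_).mul ?_
    · exact (((differentiable_const _).mul ((((differentiable_id).add_const _).sub_const _).sub
        (((differentiable_id).add_const _).add_const _)))).cexp
    · exact (differentiable_const _).mul (Complex.differentiable_one_div_Gamma.comp (((differentiable_id).add_const _).add_const _))
    · refine ((differentiable_const _).mul ?_).mul ?_
      · exact Complex.differentiable_one_div_Gamma.comp (((differentiable_id).add_const _).sub_const _)
      · exact Complex.differentiable_one_div_Gamma.comp ((((differentiable_id).add_const _).sub_const _).sub_const _)
  have hR : DifferentiableOn ℂ (fun s : ℂ => (Real.pi : ℂ) / (((aᴴ * ((2 : ℂ) • V) * a) 0 0).re) * cexp (-(((((aᴴ * ((2 : ℂ) • V) * a) 0 0).re) * (Real.pi * t) : ℝ) : ℂ)) *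
      ((1 / ((((((aᴴ * ((2 : ℂ) • V) * a) 1 1).re) - normSq ((aᴴ * ((2 : ℂ) • V) * a) 0 1) / (((aᴴ * ((2 : ℂ) • V) * a) 0 0).re) : ℝ)) : ℂ)) ^ ((s + 1 - k / 2) + (s + 1 + k / 2) - 2) * Complex.Gamma (2 * s))) {s : ℂ | 0 < s.re} := by
    refine ((differentiableOn_const _).mul ?_)
    refine DifferentiableOn.mul (fun s _ => ?_) differentiableOn_Gamma_two_mul
    exact (((((differentiableAt_id).add_const _).sub_const _).add (((differentiableAt_id).add_const _).add_const _)).sub_const _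
      |>.const_cpow (Or.inl hq0)).differentiableWithinAt
  exact hP.differentiableOn.mul (((differentiableOn_const _).mul (hC.differentiableOn.mul (hR.mul ((hΦa _ _ _ hp).mono hsub)))))

/-- Negative index: VANISHING where `Γ(s + 1 + k/2)⁻¹ = 0`. [Shimura1982, (4.34.K)] -/
theorem continuedFormula_neg_eq_zero_of_alpha (k : ℤ) (h : Matrix (Fin 2 ⊕ Fin 2) (Fin 2 ⊕ Fin 2) ℂ) (a : Matrix (Fin 2) (Fin 2) ℂ) (t : ℝ)
    (Φ : ℂ → ℂ → ℝ → ℂ → ℂ) {s : ℂ} (hα : ∃ m : ℕ, s + 1 + k / 2 = -(m : ℂ)) :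
    ((denom h (I • (1 : Matrix (Fin 2) (Fin 2) ℂ))).det ^ (-k) *
        (((‖(denom h (I • (1 : Matrix (Fin 2) (Fin 2) ℂ))).det‖ : ℝ)) : ℂ) ^ ((k : ℂ) - 2 * s - 2) *
        cexp ((2 * Real.pi * I) * ((-(a * hermTwo (t, 0, 0) * aᴴ)) * ((2 : ℂ)⁻¹ • (moeb h (I • (1 : Matrix (Fin 2) (Fin 2) ℂ)) + (moeb h (I • (1 : Matrix (Fin 2) (Fin 2) ℂ)))ᴴ))).trace)) *
      ((1 / 8 : ℂ) * ((((4 * Real.pi ^ 4 : ℝ)) : ℂ) * cexp ((Real.pi * I) * ((s + 1 - k / 2) - (s + 1 + k / 2))) *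
        ((Real.pi : ℂ)⁻¹ * (Complex.Gamma (s + 1 + k / 2))⁻¹) *
        ((Real.pi : ℂ)⁻¹ * (Complex.Gamma (s + 1 - k / 2))⁻¹ * (Complex.Gamma (s + 1 - k / 2 - 1))⁻¹) *
        ((Real.pi : ℂ) / (((aᴴ * ((2 : ℂ) • ((2 * I)⁻¹ • (moeb h (I • (1 : Matrix (Fin 2) (Fin 2) ℂ)) - (moeb h (I • (1 : Matrix (Fin 2) (Fin 2) ℂ)))ᴴ))) * a) 0 0).re) * cexp (-(((((aᴴ * ((2 : ℂ) • ((2 * I)⁻¹ • (moeb h (I • (1 : Matrix (Fin 2) (Fin 2) ℂ)) - (moeb h (I • (1 : Matrix (Fin 2) (Fin 2) ℂ)))ᴴ))) * a) 0 0).re) * (Real.pi * t) : ℝ) : ℂ)) *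
          ((1 / (((((aᴴ * ((2 : ℂ) • ((2 * I)⁻¹ • (moeb h (I • (1 : Matrix (Fin 2) (Fin 2) ℂ)) - (moeb h (I • (1 : Matrix (Fin 2) (Fin 2) ℂ)))ᴴ))) * a) 1 1).re) - normSq ((aᴴ * ((2 : ℂ) • ((2 * I)⁻¹ • (moeb h (I • (1 : Matrix (Fin 2) (Fin 2) ℂ)) - (moeb h (I • (1 : Matrix (Fin 2) (Fin 2) ℂ)))ᴴ))) * a) 0 1) / (((aᴴ * ((2 : ℂ) • ((2 * I)⁻¹ • (moeb h (I • (1 : Matrix (Fin 2) (Fin 2) ℂ)) - (moeb h (I • (1 : Matrix (Fin 2) (Fin 2) ℂ)))ᴴ))) * a) 0 0).re) : ℝ) : ℂ)) ^ ((s + 1 - k / 2) + (s + 1 + k / 2) - 2) * Complex.Gamma (2 * s)) *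
        Φ (1 - k / 2) (1 + k / 2) (((aᴴ * ((2 : ℂ) • ((2 * I)⁻¹ • (moeb h (I • (1 : Matrix (Fin 2) (Fin 2) ℂ)) - (moeb h (I • (1 : Matrix (Fin 2) (Fin 2) ℂ)))ᴴ))) * a) 0 0).re) s))) = 0 := by
  obtain ⟨m, hm⟩ := hα
  rw [hm, Complex.Gamma_neg_nat_eq_zero, _root_.inv_zero, mul_zero]
  simp

/-- Negative index: VANISHING where `Γ(s + 1 − k/2)⁻¹Γ(s − k/2)⁻¹ = 0`. [Shimura1982, (4.34.K)] -/
theorem continuedFormula_neg_eq_zero_of_beta (k : ℤ) (h : Matrix (Fin 2 ⊕ Fin 2) (Fin 2 ⊕ Fin 2) ℂ) (a : Matrix (Fin 2) (Fin 2) ℂ) (t : ℝ)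
    (Φ : ℂ → ℂ → ℝ → ℂ → ℂ) {s : ℂ} (hβ : ∃ m : ℕ, s + 1 - k / 2 = -(m : ℂ) ∨ s + 1 - k / 2 - 1 = -(m : ℂ)) :
    ((denom h (I • (1 : Matrix (Fin 2) (Fin 2) ℂ))).det ^ (-k) *
        (((‖(denom h (I • (1 : Matrix (Fin 2) (Fin 2) ℂ))).det‖ : ℝ)) : ℂ) ^ ((k : ℂ) - 2 * s - 2) *
        cexp ((2 * Real.pi * I) * ((-(a * hermTwo (t, 0, 0) * aᴴ)) * ((2 : ℂ)⁻¹ • (moeb h (I • (1 : Matrix (Fin 2) (Fin 2) ℂ)) + (moeb h (I • (1 : Matrix (Fin 2) (Fin 2) ℂ)))ᴴ))).trace)) *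
      ((1 / 8 : ℂ) * ((((4 * Real.pi ^ 4 : ℝ)) : ℂ) * cexp ((Real.pi * I) * ((s + 1 - k / 2) - (s + 1 + k / 2))) *
        ((Real.pi : ℂ)⁻¹ * (Complex.Gamma (s + 1 + k / 2))⁻¹) *
        ((Real.pi : ℂ)⁻¹ * (Complex.Gamma (s + 1 - k / 2))⁻¹ * (Complex.Gamma (s + 1 - k / 2 - 1))⁻¹) *
        ((Real.pi : ℂ) / (((aᴴ * ((2 : ℂ) • ((2 * I)⁻¹ • (moeb h (I • (1 : Matrix (Fin 2) (Fin 2) ℂ)) - (moeb h (I • (1 : Matrix (Fin 2) (Fin 2) ℂ)))ᴴ))) * a) 0 0).re) * cexp (-(((((aᴴ * ((2 : ℂ) • ((2 * I)⁻¹ • (moeb h (I • (1 : Matrix (Fin 2) (Fin 2) ℂ)) - (moeb h (I • (1 : Matrix (Fin 2) (Fin 2) ℂ)))ᴴ))) * a) 0 0).re) * (Real.pi * t) : ℝ) : ℂ)) *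
          ((1 / (((((aᴴ * ((2 : ℂ) • ((2 * I)⁻¹ • (moeb h (I • (1 : Matrix (Fin 2) (Fin 2) ℂ)) - (moeb h (I • (1 : Matrix (Fin 2) (Fin 2) ℂ)))ᴴ))) * a) 1 1).re) - normSq ((aᴴ * ((2 : ℂ) • ((2 * I)⁻¹ • (moeb h (I • (1 : Matrix (Fin 2) (Fin 2) ℂ)) - (moeb h (I • (1 : Matrix (Fin 2) (Fin 2) ℂ)))ᴴ))) * a) 0 1) / (((aᴴ * ((2 : ℂ) • ((2 * I)⁻¹ • (moeb h (I • (1 : Matrix (Fin 2) (Fin 2) ℂ)) - (moeb h (I • (1 : Matrix (Fin 2) (Fin 2) ℂ)))ᴴ))) * a) 0 0).re) : ℝ) : ℂ)) ^ ((s + 1 - k / 2) + (s + 1 + k / 2) - 2) * Complex.Gamma (2 * s)) *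
        Φ (1 - k / 2) (1 + k / 2) (((aᴴ * ((2 : ℂ) • ((2 * I)⁻¹ • (moeb h (I • (1 : Matrix (Fin 2) (Fin 2) ℂ)) - (moeb h (I • (1 : Matrix (Fin 2) (Fin 2) ℂ)))ᴴ))) * a) 0 0).re) s))) = 0 := by
  obtain ⟨m, hm | hm⟩ := hβ
  · rw [hm, Complex.Gamma_neg_nat_eq_zero, _root_.inv_zero, mul_zero, zero_mul]
    simp
  · rw [hm, Complex.Gamma_neg_nat_eq_zero, _root_.inv_zero, mul_zero]
    simp

/-- **THE SCALAR-TYPE ARCH LETTERS, EXPLICIT, WITH THE SIGN LETTER — NEGATIVE INDEX `T = −a·diag(t,0)·aᴴ`** (`‖det a‖ = 1`, `t > 0`, `−k/2 < N`): `Ac` with (hAc),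
(hA) on `{½ < re}`, and `Ac s h = 0` whenever `s + 1 + k/2 ∈ −ℕ`, resp. `s + 1 − k/2 ∈ −ℕ` or `s − k/2 ∈ −ℕ`. [Shimura1982, (1.28), §4 Thm. 4.2] [GanQiuTakeda2014, §6.4] -/
theorem exists_archLetters_scalarType_explicit_neg (k : ℤ) {a : Matrix (Fin 2) (Fin 2) ℂ} (hdet : ‖a.det‖ = 1) {t : ℝ} (ht : 0 < t) {N : ℕ}
    (hN : -(k : ℝ) / 2 < N) :
    ∃ Ac : ℂ → Matrix (Fin 2 ⊕ Fin 2) (Fin 2 ⊕ Fin 2) ℂ → ℂ,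
      (∀ h : Matrix (Fin 2 ⊕ Fin 2) (Fin 2 ⊕ Fin 2) ℂ, hᴴ * Matrix.J (Fin 2) ℂ * h = Matrix.J (Fin 2) ℂ →
        DifferentiableOn ℂ (fun s => Ac s h) {s : ℂ | 0 < s.re}) ∧
      (∀ s : ℂ, 1 / 2 < s.re → ∀ h : Matrix (Fin 2 ⊕ Fin 2) (Fin 2 ⊕ Fin 2) ℂ, hᴴ * Matrix.J (Fin 2) ℂ * h = Matrix.J (Fin 2) ℂ →
        (∫ r : Fin 2 → Fin 2 → ℝ, cexp (-(2 * Real.pi * I) * ((-(a * hermTwo (t, 0, 0) * aᴴ)) * hermOfReal r).trace) *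
          archScalarSection k s (Matrix.J (Fin 2) ℂ * fromBlocks 1 (hermOfReal r) 0 1 * h)) = Ac s h) ∧
      (∀ (s : ℂ) (h : Matrix (Fin 2 ⊕ Fin 2) (Fin 2 ⊕ Fin 2) ℂ), (∃ m : ℕ, s + 1 + k / 2 = -(m : ℂ)) → Ac s h = 0) ∧
      (∀ (s : ℂ) (h : Matrix (Fin 2 ⊕ Fin 2) (Fin 2 ⊕ Fin 2) ℂ), (∃ m : ℕ, s + 1 - k / 2 = -(m : ℂ) ∨ s + 1 - k / 2 - 1 = -(m : ℂ)) → Ac s h = 0) := by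
  have ha0 : a.det ≠ 0 := fun h0 => by rw [h0, norm_zero] at hdet; exact zero_ne_one hdet
  have haU : IsUnit a := (Matrix.isUnit_iff_isUnit_det a).mpr (Ne.isUnit ha0)
  have hπt : 0 < Real.pi * t := by positivity
  obtain ⟨Φ, hΦa, hΦb, -, -⟩ := exists_continuation_jIntegral_param hπt N
  refine ⟨fun s h =>
      ((denom h (I • (1 : Matrix (Fin 2) (Fin 2) ℂ))).det ^ (-k) *
          (((‖(denom h (I • (1 : Matrix (Fin 2) (Fin 2) ℂ))).det‖ : ℝ)) : ℂ) ^ ((k : ℂ) - 2 * s - 2) *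
          cexp ((2 * Real.pi * I) * ((-(a * hermTwo (t, 0, 0) * aᴴ)) * ((2 : ℂ)⁻¹ • (moeb h (I • (1 : Matrix (Fin 2) (Fin 2) ℂ)) + (moeb h (I • (1 : Matrix (Fin 2) (Fin 2) ℂ)))ᴴ))).trace)) *
        ((1 / 8 : ℂ) * ((((4 * Real.pi ^ 4 : ℝ)) : ℂ) * cexp ((Real.pi * I) * ((s + 1 - k / 2) - (s + 1 + k / 2))) *
          ((Real.pi : ℂ)⁻¹ * (Complex.Gamma (s + 1 + k / 2))⁻¹) *
          ((Real.pi : ℂ)⁻¹ * (Complex.Gamma (s + 1 - k / 2))⁻¹ * (Complex.Gamma (s + 1 - k / 2 - 1))⁻¹) *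
          ((Real.pi : ℂ) / (((aᴴ * ((2 : ℂ) • ((2 * I)⁻¹ • (moeb h (I • (1 : Matrix (Fin 2) (Fin 2) ℂ)) - (moeb h (I • (1 : Matrix (Fin 2) (Fin 2) ℂ)))ᴴ))) * a) 0 0).re) * cexp (-(((((aᴴ * ((2 : ℂ) • ((2 * I)⁻¹ • (moeb h (I • (1 : Matrix (Fin 2) (Fin 2) ℂ)) - (moeb h (I • (1 : Matrix (Fin 2) (Fin 2) ℂ)))ᴴ))) * a) 0 0).re) * (Real.pi * t) : ℝ) : ℂ)) *
            ((1 / (((((aᴴ * ((2 : ℂ) • ((2 * I)⁻¹ • (moeb h (I • (1 : Matrix (Fin 2) (Fin 2) ℂ)) - (moeb h (I • (1 : Matrix (Fin 2) (Fin 2) ℂ)))ᴴ))) * a) 1 1).re) - normSq ((aᴴ * ((2 : ℂ) • ((2 * I)⁻¹ • (moeb h (I • (1 : Matrix (Fin 2) (Fin 2) ℂ)) - (moeb h (I • (1 : Matrix (Fin 2) (Fin 2) ℂ)))ᴴ))) * a) 0 1) / (((aᴴ * ((2 : ℂ) • ((2 * I)⁻¹ • (moeb h (I • (1 : Matrix (Fin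 2) (Fin 2) ℂ)) - (moeb h (I • (1 : Matrix (Fin 2) (Fin 2) ℂ)))ᴴ))) * a) 0 0).re) : ℝ) : ℂ)) ^ ((s + 1 - k / 2) + (s + 1 + k / 2) - 2) * Complex.Gamma (2 * s)) *
          Φ (1 - k / 2) (1 + k / 2) (((aᴴ * ((2 : ℂ) • ((2 * I)⁻¹ • (moeb h (I • (1 : Matrix (Fin 2) (Fin 2) ℂ)) - (moeb h (I • (1 : Matrix (Fin 2) (Fin 2) ℂ)))ᴴ))) * a) 0 0).re) s))),
    fun h hh => differentiableOn_continuedFormula_neg k hh a haU t hN Φ hΦa, fun s hs h hh => ?_,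
    fun s h hα => continuedFormula_neg_eq_zero_of_alpha k h a t Φ hα, fun s h hβ => continuedFormula_neg_eq_zero_of_beta k h a t Φ hβ⟩
  set V : Matrix (Fin 2) (Fin 2) ℂ := ((2 * I)⁻¹ • (moeb h (I • (1 : Matrix (Fin 2) (Fin 2) ℂ)) - (moeb h (I • (1 : Matrix (Fin 2) (Fin 2) ℂ)))ᴴ)) with hV
  have hVpos : V.PosDef := posDef_im_moeb hh posDef_im_I_smul_one
  have h2V : ((2 : ℂ) • V).PosDef := by
    have h := hVpos.smul (by norm_num : (0 : ℝ) < 2)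
    rwa [show ((2 : ℝ) • V) = ((2 : ℂ) • V) by rw [← Complex.coe_smul]; norm_num] at h
  have hg' : (aᴴ * ((2 : ℂ) • V) * a).PosDef := by
    have := Matrix.IsUnit.posDef_star_left_conjugate_iff (x := (2 : ℂ) • V) haU
    rw [Matrix.star_eq_conjTranspose] at this
    exact this.mpr h2V
  have he := hermTwo_eq_of_isHermitian hg'.1
  exact twistedArchBlock_scalarType_eq_continued_neg k hh hdet ht hN he Φ hΦa hΦb hs

end Summit.HodgeConjecture.HodgeConjecture.Cruxes.HLiu418.K2LiuArchTwistedScalarLettersExplicit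

end
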